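import Summits.Parity.GeneralizedHardyLittlewood.Theorems.PrimeLevelFamEdgeMomentsBeyondDiagonalDiagRemTwoTwoMonomials
import HarnessLib

/-!
# Route `PrimeLevelFamEdge`, crux K_A `MomentsBeyondDiagonal` (stmt-Parity-20007), line «petersson_layers» v4, stub `stub_diag`:
# **the monomial bookkeeping of the order-`(3,3)` remainder weight** (brick B3 of the remainder estimate (R₃₃), abstract form)

Brick B3 of (R₃₃) (hypothesis `hR` of `…DiagDecorOrderThreeThreeAssembly.orderThreeThree_target_of_poly_of_remainder`,
lineage famedge-2): the order-`(3,3)` twin of `…DiagRemOneThreeMonomials` / `…DiagRemTwoTwoMonomials`. The Hecke-summed weight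
`Wt₃₃` (`…DiagDecorOrderThreeThreeHecke.selbergOrderThreeThree_hecke_eq`; `L = 2β + ℓ⁺₁ + ℓ⁺₂`, `S_m = P_m(k₁)+P_m(k₂)`) splits, with
`3S₂² − 2S₄ = D₄(k₁) + D₄(k₂) + 6P₂(k₁)P₂(k₂)` and `15S₂³ − 30S₂S₄ + 16S₆ = D₆(k₁) + D₆(k₂) + 15P₂(k₁)D₄(k₂) + 15D₄(k₁)P₂(k₂)`
(`D₄ = 3P₂² − 2P₄`, `D₆ = 15P₂³ − 30P₂P₄ + 16P₆`), into `60` monomials of SIX decoration types: undecorated (16 kernels), one-sided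
`P₂` / `D₄` / `D₆` columns (rows moved by `k₁ ↔ k₂`), both-sided `P₂ ⊗ P₂` (kernels `r₀₀ [L²], r₀₁, r₁₀ [L], r₀₂, r₂₀, r₁₁`) and
both-sided `P₂ ⊗ D₄ · r₀₀`; with `…DiagRemTwoTwoLpow.abs_Lpow_monomial_le` (`L^p ↦ (4Λ)^p`) the prefactors add up to
`729Λ⁶ / 140Λ⁴ / 5Λ² / 1 / 15Λ² / 1` against the six envelopes `Ψ₀, Ψ₂, Ψ₄, Ψ₆, Ψ_B, Ψ_BD` (homogeneous weight `6`).

* `sum_swap_both_Lpow` — the swap `k₁ ↔ k₂` for a both-sided monomial with two different decorations;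
* `abs_monomial_weight_le₃₃` — **one profile monomial against `Wt₃₃`:
  `≤ (729Λ⁶Ψ₀ + 140Λ⁴Ψ₂ + 5Λ²Ψ₄ + Ψ₆ + 15Λ²Ψ_B + Ψ_BD)·log^{m₁+m₂}Y`** (the profile corollary is filed separately).

Def-free; theorems only. Helper `--supports stmt-Parity-20007`; closes nothing; K_A, K_B and the Parity summit are NOT
proved; nothing about Landau–Siegel zeros.

## References
* E. Kowalski, P. Michel, J. VanderKam, J. reine angew. Math. 526 (2000), (22)–(28) pp. 12–15 and Prop. 5.1 p. 18.
  [cite: KowalskiMichelVanderKam2000, (23)–(28) — derivation (order-(3,3) remainder weight, monomial bookkeeping)]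
-/

noncomputable section

open Finset Real Polynomial

namespace Summit.Parity.GeneralizedHardyLittlewood.Theorems.MomentsBeyondDiagonal.DiagCorner

open Summit.Parity.GeneralizedHardyLittlewood.Theorems.BeyondDiagonalBeatsQuarter.Corner

/-- Swapping the two decorations of a both-sided monomial by `k₁ ↔ k₂` (`L` and `αk₁k₂` are symmetric). [folklore] -/
theorem sum_swap_both_Lpow (a D E : ℕ → ℝ) (R : ℝ → ℝ) (Y α β : ℝ) (m₁ m₂ p : ℕ) (I : Finset ℕ) :
    ∑ k₁ ∈ I, ∑ k₂ ∈ I, (a k₁ * D k₁) * (a k₂ * E k₂) * ellp Y k₁ ^ m₁ * ellp Y k₂ ^ m₂ *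
        ((2 * β + ellp Y k₁ + ellp Y k₂) ^ p * R (α * k₁ * k₂)) =
      ∑ k₁ ∈ I, ∑ k₂ ∈ I, (a k₁ * E k₁) * (a k₂ * D k₂) * ellp Y k₁ ^ m₂ * ellp Y k₂ ^ m₁ *
        ((2 * β + ellp Y k₁ + ellp Y k₂) ^ p * R (α * k₁ * k₂)) := by
  rw [Finset.sum_comm]
  refine Finset.sum_congr rfl fun k₁ _ ↦ Finset.sum_congr rfl fun k₂ _ ↦ ?_
  rw [show α * (k₂ : ℝ) * k₁ = α * k₁ * k₂ by ring,
    show 2 * β + ellp Y k₂ + ellp Y k₁ = 2 * β + ellp Y k₁ + ellp Y k₂ by ring]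
  ring

set_option maxHeartbeats 4000000 in
-- 60 monomial bounds combined by `linarith`
/-- **One monomial `ℓ⁺(k₁)^{m₁}ℓ⁺(k₂)^{m₂}` (`m₁, m₂ ≥ 1`) against the order-`(3,3)` remainder weight `Wt₃₃`** (module docstring).
[cite: KowalskiMichelVanderKam2000, (23)–(28) — derivation (order-(3,3) remainder weight, one monomial)] -/
theorem abs_monomial_weight_le₃₃ {a P2 P4 P6 : ℕ → ℝ}
    {R₀₀ R₀₁ R₀₂ R₀₃ R₁₀ R₁₁ R₁₂ R₁₃ R₂₀ R₂₁ R₂₂ R₂₃ R₃₀ R₃₁ R₃₂ R₃₃ : ℝ → ℝ}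
    {Y α β Λ Ψ₀ Ψ₂ Ψ₄ Ψ₆ ΨB ΨBD : ℝ} {m₁ m₂ : ℕ}
    (hm₁ : 1 ≤ m₁) (hm₂ : 1 ≤ m₂) (hY : 1 ≤ Y) (hΛ : 1 ≤ Λ) (hβ : |β| ≤ Λ) (hLY : Real.log Y ≤ Λ)
    (hΨ₀ : 0 ≤ Ψ₀) (hΨ₂ : 0 ≤ Ψ₂) (hΨ₄ : 0 ≤ Ψ₄) (hΨ₆ : 0 ≤ Ψ₆) (hΨB : 0 ≤ ΨB) (hΨBD : 0 ≤ ΨBD)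
    (h0 : ∀ R : ℝ → ℝ, (R = R₀₀ ∨ R = R₀₁ ∨ R = R₀₂ ∨ R = R₀₃ ∨ R = R₁₀ ∨ R = R₁₁ ∨ R = R₁₂ ∨ R = R₁₃ ∨ R = R₂₀ ∨ R = R₂₁ ∨ R = R₂₂ ∨ R = R₂₃ ∨ R = R₃₀ ∨ R = R₃₁ ∨ R = R₃₂ ∨ R = R₃₃) →
      ∀ i j : ℕ, 1 ≤ i → 1 ≤ j →
      |∑ k₁ ∈ Icc 1 ⌊Y⌋₊, ∑ k₂ ∈ Icc 1 ⌊Y⌋₊,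
          a k₁ * a k₂ * ellp Y k₁ ^ i * ellp Y k₂ ^ j * R (α * k₁ * k₂)| ≤ Real.log Y ^ (i + j) * Ψ₀)
    (h2 : ∀ R : ℝ → ℝ, (R = R₀₀ ∨ R = R₀₁ ∨ R = R₀₃ ∨ R = R₁₀ ∨ R = R₁₁ ∨ R = R₁₂ ∨ R = R₁₃ ∨ R = R₂₁ ∨ R = R₂₂ ∨ R = R₃₀ ∨ R = R₃₁) →
      ∀ i j : ℕ, 1 ≤ i → 1 ≤ j →
      |∑ k₁ ∈ Icc 1 ⌊Y⌋₊, ∑ k₂ ∈ Icc 1 ⌊Y⌋₊,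
          a k₁ * (a k₂ * P2 k₂) * ellp Y k₁ ^ i * ellp Y k₂ ^ j * R (α * k₁ * k₂)| ≤ Real.log Y ^ (i + j) * Ψ₂)
    (h4 : ∀ R : ℝ → ℝ, (R = R₀₀ ∨ R = R₀₁ ∨ R = R₀₂ ∨ R = R₁₀ ∨ R = R₁₁ ∨ R = R₂₀) →
      ∀ i j : ℕ, 1 ≤ i → 1 ≤ j →
      |∑ k₁ ∈ Icc 1 ⌊Y⌋₊, ∑ k₂ ∈ Icc 1 ⌊Y⌋₊,
          a k₁ * (a k₂ * (3 * P2 k₂ ^ 2 - 2 * P4 k₂)) * ellp Y k₁ ^ i * ellp Y k₂ ^ j * R (α * k₁ * k₂)| ≤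
        Real.log Y ^ (i + j) * Ψ₄)
    (h6 : ∀ i j : ℕ, 1 ≤ i → 1 ≤ j →
      |∑ k₁ ∈ Icc 1 ⌊Y⌋₊, ∑ k₂ ∈ Icc 1 ⌊Y⌋₊,
          a k₁ * (a k₂ * (15 * P2 k₂ ^ 3 - 30 * P2 k₂ * P4 k₂ + 16 * P6 k₂)) * ellp Y k₁ ^ i * ellp Y k₂ ^ j *
            R₀₀ (α * k₁ * k₂)| ≤ Real.log Y ^ (i + j) * Ψ₆)
    (hB : ∀ R : ℝ → ℝ, (R = R₀₀ ∨ R = R₀₁ ∨ R = R₁₀ ∨ R = R₀₂ ∨ R = R₂₀ ∨ R = R₁₁) →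
      ∀ i j : ℕ, 1 ≤ i → 1 ≤ j →
      |∑ k₁ ∈ Icc 1 ⌊Y⌋₊, ∑ k₂ ∈ Icc 1 ⌊Y⌋₊,
          (a k₁ * P2 k₁) * (a k₂ * P2 k₂) * ellp Y k₁ ^ i * ellp Y k₂ ^ j * R (α * k₁ * k₂)| ≤
        Real.log Y ^ (i + j) * ΨB)
    (hBD : ∀ i j : ℕ, 1 ≤ i → 1 ≤ j →
      |∑ k₁ ∈ Icc 1 ⌊Y⌋₊, ∑ k₂ ∈ Icc 1 ⌊Y⌋₊,
          (a k₁ * P2 k₁) * (a k₂ * (3 * P2 k₂ ^ 2 - 2 * P4 k₂)) * ellp Y k₁ ^ i * ellp Y k₂ ^ j * R₀₀ (α * k₁ * k₂)| ≤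
        Real.log Y ^ (i + j) * ΨBD) :
    |∑ k₁ ∈ Icc 1 ⌊Y⌋₊, ∑ k₂ ∈ Icc 1 ⌊Y⌋₊,
        a k₁ * a k₂ * ellp Y k₁ ^ m₁ * ellp Y k₂ ^ m₂ *
          (((2 * β + ellp Y k₁ + ellp Y k₂) ^ 6 - 3 * (2 * β + ellp Y k₁ + ellp Y k₂) ^ 4 * (P2 k₁ + P2 k₂) + 9 * (2 * β + ellp Y k₁ + ellp Y k₂) ^ 2 * (P2 k₁ + P2 k₂) ^ 2 - 6 * (2 * β + ellp Y k₁ + ellp Y k₂) ^ 2 * (P4 k₁ + P4 k₂) - 15 * (P2 k₁ + P2 k₂) ^ 3 + 30 * (P2 k₁ + P2 k₂) * (P4 k₁ + P4 k₂) - 16 * (P6 k₁ + P6 k₂)) / 64 * R₀₀ (α * k₁ * k₂) +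
            (3 * (2 * β + ellp Y k₁ + ellp Y k₂) ^ 5 - 6 * (2 * β + ellp Y k₁ + ellp Y k₂) ^ 3 * (P2 k₁ + P2 k₂) + 9 * (2 * β + ellp Y k₁ + ellp Y k₂) * (P2 k₁ + P2 k₂) ^ 2 - 6 * (2 * β + ellp Y k₁ + ellp Y k₂) * (P4 k₁ + P4 k₂)) / 32 * R₀₁ (α * k₁ * k₂) +
            (3 * (2 * β + ellp Y k₁ + ellp Y k₂) ^ 4 - 9 * (P2 k₁ + P2 k₂) ^ 2 + 6 * (P4 k₁ + P4 k₂)) / 16 * R₀₂ (α * k₁ * k₂) +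
            ((2 * β + ellp Y k₁ + ellp Y k₂) ^ 3 + 3 * (2 * β + ellp Y k₁ + ellp Y k₂) * (P2 k₁ + P2 k₂)) / 8 * R₀₃ (α * k₁ * k₂) +
            (3 * (2 * β + ellp Y k₁ + ellp Y k₂) ^ 5 - 6 * (2 * β + ellp Y k₁ + ellp Y k₂) ^ 3 * (P2 k₁ + P2 k₂) + 9 * (2 * β + ellp Y k₁ + ellp Y k₂) * (P2 k₁ + P2 k₂) ^ 2 - 6 * (2 * β + ellp Y k₁ + ellp Y k₂) * (P4 k₁ + P4 k₂)) / 32 * R₁₀ (α * k₁ * k₂) +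
            (9 * (2 * β + ellp Y k₁ + ellp Y k₂) ^ 4 - 18 * (2 * β + ellp Y k₁ + ellp Y k₂) ^ 2 * (P2 k₁ + P2 k₂) + 27 * (P2 k₁ + P2 k₂) ^ 2 - 18 * (P4 k₁ + P4 k₂)) / 16 * R₁₁ (α * k₁ * k₂) +
            (9 * (2 * β + ellp Y k₁ + ellp Y k₂) ^ 3 - 9 * (2 * β + ellp Y k₁ + ellp Y k₂) * (P2 k₁ + P2 k₂)) / 8 * R₁₂ (α * k₁ * k₂) +
            (3 * (2 * β + ellp Y k₁ + ellp Y k₂) ^ 2 + 3 * (P2 k₁ + P2 k₂)) / 4 * R₁₃ (α * k₁ * k₂) +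
            (3 * (2 * β + ellp Y k₁ + ellp Y k₂) ^ 4 - 9 * (P2 k₁ + P2 k₂) ^ 2 + 6 * (P4 k₁ + P4 k₂)) / 16 * R₂₀ (α * k₁ * k₂) +
            (9 * (2 * β + ellp Y k₁ + ellp Y k₂) ^ 3 - 9 * (2 * β + ellp Y k₁ + ellp Y k₂) * (P2 k₁ + P2 k₂)) / 8 * R₂₁ (α * k₁ * k₂) +
            (9 * (2 * β + ellp Y k₁ + ellp Y k₂) ^ 2 - 9 * (P2 k₁ + P2 k₂)) / 4 * R₂₂ (α * k₁ * k₂) +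
            3 * (2 * β + ellp Y k₁ + ellp Y k₂) / 2 * R₂₃ (α * k₁ * k₂) +
            ((2 * β + ellp Y k₁ + ellp Y k₂) ^ 3 + 3 * (2 * β + ellp Y k₁ + ellp Y k₂) * (P2 k₁ + P2 k₂)) / 8 * R₃₀ (α * k₁ * k₂) +
            (3 * (2 * β + ellp Y k₁ + ellp Y k₂) ^ 2 + 3 * (P2 k₁ + P2 k₂)) / 4 * R₃₁ (α * k₁ * k₂) +
            3 * (2 * β + ellp Y k₁ + ellp Y k₂) / 2 * R₃₂ (α * k₁ * k₂) +
            R₃₃ (α * k₁ * k₂))| ≤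
      (729 * Λ ^ 6 * Ψ₀ + 140 * Λ ^ 4 * Ψ₂ + 5 * Λ ^ 2 * Ψ₄ + Ψ₆ + 15 * Λ ^ 2 * ΨB + ΨBD) * Real.log Y ^ (m₁ + m₂) := by
  have hL0 : 0 ≤ Real.log Y := Real.log_nonneg hY
  have hΛ0 : 0 ≤ Λ := zero_le_one.trans hΛ
  set I := Icc 1 ⌊Y⌋₊ with hI
  set X₀ : ℝ := Real.log Y ^ (m₁ + m₂) * Ψ₀ with hX₀
  set X₂ : ℝ := Real.log Y ^ (m₁ + m₂) * Ψ₂ with hX₂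
  set X₄ : ℝ := Real.log Y ^ (m₁ + m₂) * Ψ₄ with hX₄
  set X₆ : ℝ := Real.log Y ^ (m₁ + m₂) * Ψ₆ with hX₆
  set XB : ℝ := Real.log Y ^ (m₁ + m₂) * ΨB with hXB
  set XBD : ℝ := Real.log Y ^ (m₁ + m₂) * ΨBD with hXBD
  have hX₀0 : 0 ≤ X₀ := by positivity
  have hX₂0 : 0 ≤ X₂ := by positivity
  have hX₄0 : 0 ≤ X₄ := by positivity
  have hX₆0 : 0 ≤ X₆ := by positivity
  have hXB0 : 0 ≤ XB := by positivity
  have hXBD0 : 0 ≤ XBD := by positivity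
  have G00 := abs_Lpow_monomial_le hY hΛ hβ hLY hΨ₀ (h0 R₀₀ (Or.inl rfl))
  have G01 := abs_Lpow_monomial_le hY hΛ hβ hLY hΨ₀ (h0 R₀₁ (Or.inr (Or.inl rfl)))
  have G02 := abs_Lpow_monomial_le hY hΛ hβ hLY hΨ₀ (h0 R₀₂ (Or.inr (Or.inr (Or.inl rfl))))
  have G03 := abs_Lpow_monomial_le hY hΛ hβ hLY hΨ₀ (h0 R₀₃ (Or.inr (Or.inr (Or.inr (Or.inl rfl)))))
  have G10 := abs_Lpow_monomial_le hY hΛ hβ hLY hΨ₀ (h0 R₁₀ (Or.inr (Or.inr (Or.inr (Or.inr (Or.inl rfl))))))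
  have G11 := abs_Lpow_monomial_le hY hΛ hβ hLY hΨ₀ (h0 R₁₁ (Or.inr (Or.inr (Or.inr (Or.inr (Or.inr (Or.inl rfl)))))))
  have G12 := abs_Lpow_monomial_le hY hΛ hβ hLY hΨ₀ (h0 R₁₂ (Or.inr (Or.inr (Or.inr (Or.inr (Or.inr (Or.inr (Or.inl rfl))))))))
  have G13 := abs_Lpow_monomial_le hY hΛ hβ hLY hΨ₀ (h0 R₁₃ (Or.inr (Or.inr (Or.inr (Or.inr (Or.inr (Or.inr (Or.inr (Or.inl rfl)))))))))
  have G20 := abs_Lpow_monomial_le hY hΛ hβ hLY hΨ₀ (h0 R₂₀ (Or.inr (Or.inr (Or.inr (Or.inr (Or.inr (Or.inr (Or.inr (Or.inr (Or.inl rfl))))))))))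
  have G21 := abs_Lpow_monomial_le hY hΛ hβ hLY hΨ₀ (h0 R₂₁ (Or.inr (Or.inr (Or.inr (Or.inr (Or.inr (Or.inr (Or.inr (Or.inr (Or.inr (Or.inl rfl)))))))))))
  have G22 := abs_Lpow_monomial_le hY hΛ hβ hLY hΨ₀ (h0 R₂₂ (Or.inr (Or.inr (Or.inr (Or.inr (Or.inr (Or.inr (Or.inr (Or.inr (Or.inr (Or.inr (Or.inl rfl))))))))))))
  have G23 := abs_Lpow_monomial_le hY hΛ hβ hLY hΨ₀ (h0 R₂₃ (Or.inr (Or.inr (Or.inr (Or.inr (Or.inr (Or.inr (Or.inr (Or.inr (Or.inr (Or.inr (Or.inr (Or.inl rfl)))))))))))))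
  have G30 := abs_Lpow_monomial_le hY hΛ hβ hLY hΨ₀ (h0 R₃₀ (Or.inr (Or.inr (Or.inr (Or.inr (Or.inr (Or.inr (Or.inr (Or.inr (Or.inr (Or.inr (Or.inr (Or.inr (Or.inl rfl))))))))))))))
  have G31 := abs_Lpow_monomial_le hY hΛ hβ hLY hΨ₀ (h0 R₃₁ (Or.inr (Or.inr (Or.inr (Or.inr (Or.inr (Or.inr (Or.inr (Or.inr (Or.inr (Or.inr (Or.inr (Or.inr (Or.inr (Or.inl rfl)))))))))))))))
  have G32 := abs_Lpow_monomial_le hY hΛ hβ hLY hΨ₀ (h0 R₃₂ (Or.inr (Or.inr (Or.inr (Or.inr (Or.inr (Or.inr (Or.inr (Or.inr (Or.inr (Or.inr (Or.inr (Or.inr (Or.inr (Or.inr (Or.inl rfl))))))))))))))))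
  have G33 := abs_Lpow_monomial_le hY hΛ hβ hLY hΨ₀ (h0 R₃₃ (Or.inr (Or.inr (Or.inr (Or.inr (Or.inr (Or.inr (Or.inr (Or.inr (Or.inr (Or.inr (Or.inr (Or.inr (Or.inr (Or.inr (Or.inr rfl))))))))))))))))
  have P00 := abs_Lpow_monomial_le hY hΛ hβ hLY hΨ₂ (h2 R₀₀ (Or.inl rfl))
  have P01 := abs_Lpow_monomial_le hY hΛ hβ hLY hΨ₂ (h2 R₀₁ (Or.inr (Or.inl rfl)))
  have P03 := abs_Lpow_monomial_le hY hΛ hβ hLY hΨ₂ (h2 R₀₃ (Or.inr (Or.inr (Or.inl rfl))))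
  have P10 := abs_Lpow_monomial_le hY hΛ hβ hLY hΨ₂ (h2 R₁₀ (Or.inr (Or.inr (Or.inr (Or.inl rfl)))))
  have P11 := abs_Lpow_monomial_le hY hΛ hβ hLY hΨ₂ (h2 R₁₁ (Or.inr (Or.inr (Or.inr (Or.inr (Or.inl rfl))))))
  have P12 := abs_Lpow_monomial_le hY hΛ hβ hLY hΨ₂ (h2 R₁₂ (Or.inr (Or.inr (Or.inr (Or.inr (Or.inr (Or.inl rfl)))))))
  have P13 := abs_Lpow_monomial_le hY hΛ hβ hLY hΨ₂ (h2 R₁₃ (Or.inr (Or.inr (Or.inr (Or.inr (Or.inr (Or.inr (Or.inl rfl))))))))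
  have P21 := abs_Lpow_monomial_le hY hΛ hβ hLY hΨ₂ (h2 R₂₁ (Or.inr (Or.inr (Or.inr (Or.inr (Or.inr (Or.inr (Or.inr (Or.inl rfl)))))))))
  have P22 := abs_Lpow_monomial_le hY hΛ hβ hLY hΨ₂ (h2 R₂₂ (Or.inr (Or.inr (Or.inr (Or.inr (Or.inr (Or.inr (Or.inr (Or.inr (Or.inl rfl))))))))))
  have P30 := abs_Lpow_monomial_le hY hΛ hβ hLY hΨ₂ (h2 R₃₀ (Or.inr (Or.inr (Or.inr (Or.inr (Or.inr (Or.inr (Or.inr (Or.inr (Or.inr (Or.inl rfl)))))))))))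
  have P31 := abs_Lpow_monomial_le hY hΛ hβ hLY hΨ₂ (h2 R₃₁ (Or.inr (Or.inr (Or.inr (Or.inr (Or.inr (Or.inr (Or.inr (Or.inr (Or.inr (Or.inr rfl)))))))))))
  have D00 := abs_Lpow_monomial_le hY hΛ hβ hLY hΨ₄ (h4 R₀₀ (Or.inl rfl))
  have D01 := abs_Lpow_monomial_le hY hΛ hβ hLY hΨ₄ (h4 R₀₁ (Or.inr (Or.inl rfl)))
  have D02 := abs_Lpow_monomial_le hY hΛ hβ hLY hΨ₄ (h4 R₀₂ (Or.inr (Or.inr (Or.inl rfl))))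
  have D10 := abs_Lpow_monomial_le hY hΛ hβ hLY hΨ₄ (h4 R₁₀ (Or.inr (Or.inr (Or.inr (Or.inl rfl)))))
  have D11 := abs_Lpow_monomial_le hY hΛ hβ hLY hΨ₄ (h4 R₁₁ (Or.inr (Or.inr (Or.inr (Or.inr (Or.inl rfl))))))
  have D20 := abs_Lpow_monomial_le hY hΛ hβ hLY hΨ₄ (h4 R₂₀ (Or.inr (Or.inr (Or.inr (Or.inr (Or.inr rfl))))))
  have S00 := abs_Lpow_monomial_le hY hΛ hβ hLY hΨ₆ h6
  have B00 := abs_Lpow_monomial_le hY hΛ hβ hLY hΨB (hB R₀₀ (Or.inl rfl))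
  have B01 := abs_Lpow_monomial_le hY hΛ hβ hLY hΨB (hB R₀₁ (Or.inr (Or.inl rfl)))
  have B10 := abs_Lpow_monomial_le hY hΛ hβ hLY hΨB (hB R₁₀ (Or.inr (Or.inr (Or.inl rfl))))
  have B02 := abs_Lpow_monomial_le hY hΛ hβ hLY hΨB (hB R₀₂ (Or.inr (Or.inr (Or.inr (Or.inl rfl)))))
  have B20 := abs_Lpow_monomial_le hY hΛ hβ hLY hΨB (hB R₂₀ (Or.inr (Or.inr (Or.inr (Or.inr (Or.inl rfl))))))
  have B11 := abs_Lpow_monomial_le hY hΛ hβ hLY hΨB (hB R₁₁ (Or.inr (Or.inr (Or.inr (Or.inr (Or.inr rfl))))))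
  have BD00 := abs_Lpow_monomial_le hY hΛ hβ hLY hΨBD hBD
  have g1 := G00 6 m₁ m₂ hm₁ hm₂
  have g2 := P00 4 m₂ m₁ hm₂ hm₁
  have g3 := P00 4 m₁ m₂ hm₁ hm₂
  have g4 := D00 2 m₂ m₁ hm₂ hm₁
  have g5 := D00 2 m₁ m₂ hm₁ hm₂
  have g6 := B00 2 m₁ m₂ hm₁ hm₂
  have g7 := S00 0 m₂ m₁ hm₂ hm₁
  have g8 := S00 0 m₁ m₂ hm₁ hm₂
  have g9 := BD00 0 m₁ m₂ hm₁ hm₂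
  have g10 := BD00 0 m₂ m₁ hm₂ hm₁
  have g11 := G01 5 m₁ m₂ hm₁ hm₂
  have g12 := P01 3 m₂ m₁ hm₂ hm₁
  have g13 := P01 3 m₁ m₂ hm₁ hm₂
  have g14 := D01 1 m₂ m₁ hm₂ hm₁
  have g15 := D01 1 m₁ m₂ hm₁ hm₂
  have g16 := B01 1 m₁ m₂ hm₁ hm₂
  have g17 := G10 5 m₁ m₂ hm₁ hm₂
  have g18 := P10 3 m₂ m₁ hm₂ hm₁
  have g19 := P10 3 m₁ m₂ hm₁ hm₂
  have g20 := D10 1 m₂ m₁ hm₂ hm₁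
  have g21 := D10 1 m₁ m₂ hm₁ hm₂
  have g22 := B10 1 m₁ m₂ hm₁ hm₂
  have g23 := G02 4 m₁ m₂ hm₁ hm₂
  have g24 := D02 0 m₂ m₁ hm₂ hm₁
  have g25 := D02 0 m₁ m₂ hm₁ hm₂
  have g26 := B02 0 m₁ m₂ hm₁ hm₂
  have g27 := G20 4 m₁ m₂ hm₁ hm₂
  have g28 := D20 0 m₂ m₁ hm₂ hm₁
  have g29 := D20 0 m₁ m₂ hm₁ hm₂
  have g30 := B20 0 m₁ m₂ hm₁ hm₂
  have g31 := G03 3 m₁ m₂ hm₁ hm₂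
  have g32 := P03 1 m₂ m₁ hm₂ hm₁
  have g33 := P03 1 m₁ m₂ hm₁ hm₂
  have g34 := G30 3 m₁ m₂ hm₁ hm₂
  have g35 := P30 1 m₂ m₁ hm₂ hm₁
  have g36 := P30 1 m₁ m₂ hm₁ hm₂
  have g37 := G11 4 m₁ m₂ hm₁ hm₂
  have g38 := P11 2 m₂ m₁ hm₂ hm₁
  have g39 := P11 2 m₁ m₂ hm₁ hm₂
  have g40 := D11 0 m₂ m₁ hm₂ hm₁
  have g41 := D11 0 m₁ m₂ hm₁ hm₂
  have g42 := B11 0 m₁ m₂ hm₁ hm₂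
  have g43 := G12 3 m₁ m₂ hm₁ hm₂
  have g44 := P12 1 m₂ m₁ hm₂ hm₁
  have g45 := P12 1 m₁ m₂ hm₁ hm₂
  have g46 := G21 3 m₁ m₂ hm₁ hm₂
  have g47 := P21 1 m₂ m₁ hm₂ hm₁
  have g48 := P21 1 m₁ m₂ hm₁ hm₂
  have g49 := G13 2 m₁ m₂ hm₁ hm₂
  have g50 := P13 0 m₂ m₁ hm₂ hm₁
  have g51 := P13 0 m₁ m₂ hm₁ hm₂
  have g52 := G31 2 m₁ m₂ hm₁ hm₂
  have g53 := P31 0 m₂ m₁ hm₂ hm₁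
  have g54 := P31 0 m₁ m₂ hm₁ hm₂
  have g55 := G22 2 m₁ m₂ hm₁ hm₂
  have g56 := P22 0 m₂ m₁ hm₂ hm₁
  have g57 := P22 0 m₁ m₂ hm₁ hm₂
  have g58 := G23 1 m₁ m₂ hm₁ hm₂
  have g59 := G32 1 m₁ m₂ hm₁ hm₂
  have g60 := G33 0 m₁ m₂ hm₁ hm₂
  rw [show m₂ + m₁ = m₁ + m₂ from add_comm _ _] at g2 g4 g7 g10 g12 g14 g18 g20 g24 g28 g32 g35 g38 g40 g44 g47 g50 g53 g56
  rw [← hI] at g1 g2 g3 g4 g5 g6 g7 g8 g9 g10 g11 g12 g13 g14 g15 g16 g17 g18 g19 g20 g21 g22 g23 g24 g25 g26 g27 g28 g29 g30 g31 g32 g33 g34 g35 g36 g37 g38 g39 g40 g41 g42 g43 g44 g45 g46 g47 g48 g49 g50 g51 g52 g53 g54 g55 g56 g57 g58 g59 g60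
  simp only [← hX₀, ← hX₂, ← hX₄, ← hX₆, ← hXB, ← hXBD] at g1 g2 g3 g4 g5 g6 g7 g8 g9 g10 g11 g12 g13 g14 g15 g16 g17 g18 g19 g20 g21 g22 g23 g24 g25 g26 g27 g28 g29 g30 g31 g32 g33 g34 g35 g36 g37 g38 g39 g40 g41 g42 g43 g44 g45 g46 g47 g48 g49 g50 g51 g52 g53 g54 g55 g56 g57 g58 g59 g60
  -- the decomposition of the weight into the 60 terms
  have hid : ∑ k₁ ∈ I, ∑ k₂ ∈ I,
      a k₁ * a k₂ * ellp Y k₁ ^ m₁ * ellp Y k₂ ^ m₂ *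
        (((2 * β + ellp Y k₁ + ellp Y k₂) ^ 6 - 3 * (2 * β + ellp Y k₁ + ellp Y k₂) ^ 4 * (P2 k₁ + P2 k₂) + 9 * (2 * β + ellp Y k₁ + ellp Y k₂) ^ 2 * (P2 k₁ + P2 k₂) ^ 2 - 6 * (2 * β + ellp Y k₁ + ellp Y k₂) ^ 2 * (P4 k₁ + P4 k₂) - 15 * (P2 k₁ + P2 k₂) ^ 3 + 30 * (P2 k₁ + P2 k₂) * (P4 k₁ + P4 k₂) - 16 * (P6 k₁ + P6 k₂)) / 64 * R₀₀ (α * k₁ * k₂) +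
            (3 * (2 * β + ellp Y k₁ + ellp Y k₂) ^ 5 - 6 * (2 * β + ellp Y k₁ + ellp Y k₂) ^ 3 * (P2 k₁ + P2 k₂) + 9 * (2 * β + ellp Y k₁ + ellp Y k₂) * (P2 k₁ + P2 k₂) ^ 2 - 6 * (2 * β + ellp Y k₁ + ellp Y k₂) * (P4 k₁ + P4 k₂)) / 32 * R₀₁ (α * k₁ * k₂) +
            (3 * (2 * β + ellp Y k₁ + ellp Y k₂) ^ 4 - 9 * (P2 k₁ + P2 k₂) ^ 2 + 6 * (P4 k₁ + P4 k₂)) / 16 * R₀₂ (α * k₁ * k₂) +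
            ((2 * β + ellp Y k₁ + ellp Y k₂) ^ 3 + 3 * (2 * β + ellp Y k₁ + ellp Y k₂) * (P2 k₁ + P2 k₂)) / 8 * R₀₃ (α * k₁ * k₂) +
            (3 * (2 * β + ellp Y k₁ + ellp Y k₂) ^ 5 - 6 * (2 * β + ellp Y k₁ + ellp Y k₂) ^ 3 * (P2 k₁ + P2 k₂) + 9 * (2 * β + ellp Y k₁ + ellp Y k₂) * (P2 k₁ + P2 k₂) ^ 2 - 6 * (2 * β + ellp Y k₁ + ellp Y k₂) * (P4 k₁ + P4 k₂)) / 32 * R₁₀ (α * k₁ * k₂) +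
            (9 * (2 * β + ellp Y k₁ + ellp Y k₂) ^ 4 - 18 * (2 * β + ellp Y k₁ + ellp Y k₂) ^ 2 * (P2 k₁ + P2 k₂) + 27 * (P2 k₁ + P2 k₂) ^ 2 - 18 * (P4 k₁ + P4 k₂)) / 16 * R₁₁ (α * k₁ * k₂) +
            (9 * (2 * β + ellp Y k₁ + ellp Y k₂) ^ 3 - 9 * (2 * β + ellp Y k₁ + ellp Y k₂) * (P2 k₁ + P2 k₂)) / 8 * R₁₂ (α * k₁ * k₂) +
            (3 * (2 * β + ellp Y k₁ + ellp Y k₂) ^ 2 + 3 * (P2 k₁ + P2 k₂)) / 4 * R₁₃ (α * k₁ * k₂) +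
            (3 * (2 * β + ellp Y k₁ + ellp Y k₂) ^ 4 - 9 * (P2 k₁ + P2 k₂) ^ 2 + 6 * (P4 k₁ + P4 k₂)) / 16 * R₂₀ (α * k₁ * k₂) +
            (9 * (2 * β + ellp Y k₁ + ellp Y k₂) ^ 3 - 9 * (2 * β + ellp Y k₁ + ellp Y k₂) * (P2 k₁ + P2 k₂)) / 8 * R₂₁ (α * k₁ * k₂) +
            (9 * (2 * β + ellp Y k₁ + ellp Y k₂) ^ 2 - 9 * (P2 k₁ + P2 k₂)) / 4 * R₂₂ (α * k₁ * k₂) +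
            3 * (2 * β + ellp Y k₁ + ellp Y k₂) / 2 * R₂₃ (α * k₁ * k₂) +
            ((2 * β + ellp Y k₁ + ellp Y k₂) ^ 3 + 3 * (2 * β + ellp Y k₁ + ellp Y k₂) * (P2 k₁ + P2 k₂)) / 8 * R₃₀ (α * k₁ * k₂) +
            (3 * (2 * β + ellp Y k₁ + ellp Y k₂) ^ 2 + 3 * (P2 k₁ + P2 k₂)) / 4 * R₃₁ (α * k₁ * k₂) +
            3 * (2 * β + ellp Y k₁ + ellp Y k₂) / 2 * R₃₂ (α * k₁ * k₂) +
            R₃₃ (α * k₁ * k₂)) =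
      1 / 64 * ∑ k₁ ∈ I, ∑ k₂ ∈ I, a k₁ * a k₂ * ellp Y k₁ ^ m₁ * ellp Y k₂ ^ m₂ * ((2 * β + ellp Y k₁ + ellp Y k₂) ^ 6 * R₀₀ (α * k₁ * k₂)) -
      3 / 64 * ∑ k₁ ∈ I, ∑ k₂ ∈ I, a k₁ * P2 k₁ * a k₂ * ellp Y k₁ ^ m₁ * ellp Y k₂ ^ m₂ * ((2 * β + ellp Y k₁ + ellp Y k₂) ^ 4 * R₀₀ (α * k₁ * k₂)) -
      3 / 64 * ∑ k₁ ∈ I, ∑ k₂ ∈ I, a k₁ * (a k₂ * P2 k₂) * ellp Y k₁ ^ m₁ * ellp Y k₂ ^ m₂ * ((2 * β + ellp Y k₁ + ellp Y k₂) ^ 4 * R₀₀ (α * k₁ * k₂)) +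
      3 / 64 * ∑ k₁ ∈ I, ∑ k₂ ∈ I, a k₁ * (3 * P2 k₁ ^ 2 - 2 * P4 k₁) * a k₂ * ellp Y k₁ ^ m₁ * ellp Y k₂ ^ m₂ * ((2 * β + ellp Y k₁ + ellp Y k₂) ^ 2 * R₀₀ (α * k₁ * k₂)) +
      3 / 64 * ∑ k₁ ∈ I, ∑ k₂ ∈ I, a k₁ * (a k₂ * (3 * P2 k₂ ^ 2 - 2 * P4 k₂)) * ellp Y k₁ ^ m₁ * ellp Y k₂ ^ m₂ * ((2 * β + ellp Y k₁ + ellp Y k₂) ^ 2 * R₀₀ (α * k₁ * k₂)) +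
      18 / 64 * ∑ k₁ ∈ I, ∑ k₂ ∈ I, (a k₁ * P2 k₁) * (a k₂ * P2 k₂) * ellp Y k₁ ^ m₁ * ellp Y k₂ ^ m₂ * ((2 * β + ellp Y k₁ + ellp Y k₂) ^ 2 * R₀₀ (α * k₁ * k₂)) -
      1 / 64 * ∑ k₁ ∈ I, ∑ k₂ ∈ I, a k₁ * (15 * P2 k₁ ^ 3 - 30 * P2 k₁ * P4 k₁ + 16 * P6 k₁) * a k₂ * ellp Y k₁ ^ m₁ * ellp Y k₂ ^ m₂ * ((2 * β + ellp Y k₁ + ellp Y k₂) ^ 0 * R₀₀ (α * k₁ * k₂)) -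
      1 / 64 * ∑ k₁ ∈ I, ∑ k₂ ∈ I, a k₁ * (a k₂ * (15 * P2 k₂ ^ 3 - 30 * P2 k₂ * P4 k₂ + 16 * P6 k₂)) * ellp Y k₁ ^ m₁ * ellp Y k₂ ^ m₂ * ((2 * β + ellp Y k₁ + ellp Y k₂) ^ 0 * R₀₀ (α * k₁ * k₂)) -
      15 / 64 * ∑ k₁ ∈ I, ∑ k₂ ∈ I, (a k₁ * P2 k₁) * (a k₂ * (3 * P2 k₂ ^ 2 - 2 * P4 k₂)) * ellp Y k₁ ^ m₁ * ellp Y k₂ ^ m₂ * ((2 * β + ellp Y k₁ + ellp Y k₂) ^ 0 * R₀₀ (α * k₁ * k₂)) -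
      15 / 64 * ∑ k₁ ∈ I, ∑ k₂ ∈ I, (a k₁ * (3 * P2 k₁ ^ 2 - 2 * P4 k₁)) * (a k₂ * P2 k₂) * ellp Y k₁ ^ m₁ * ellp Y k₂ ^ m₂ * ((2 * β + ellp Y k₁ + ellp Y k₂) ^ 0 * R₀₀ (α * k₁ * k₂)) +
      3 / 32 * ∑ k₁ ∈ I, ∑ k₂ ∈ I, a k₁ * a k₂ * ellp Y k₁ ^ m₁ * ellp Y k₂ ^ m₂ * ((2 * β + ellp Y k₁ + ellp Y k₂) ^ 5 * R₀₁ (α * k₁ * k₂)) -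
      6 / 32 * ∑ k₁ ∈ I, ∑ k₂ ∈ I, a k₁ * P2 k₁ * a k₂ * ellp Y k₁ ^ m₁ * ellp Y k₂ ^ m₂ * ((2 * β + ellp Y k₁ + ellp Y k₂) ^ 3 * R₀₁ (α * k₁ * k₂)) -
      6 / 32 * ∑ k₁ ∈ I, ∑ k₂ ∈ I, a k₁ * (a k₂ * P2 k₂) * ellp Y k₁ ^ m₁ * ellp Y k₂ ^ m₂ * ((2 * β + ellp Y k₁ + ellp Y k₂) ^ 3 * R₀₁ (α * k₁ * k₂)) +
      3 / 32 * ∑ k₁ ∈ I, ∑ k₂ ∈ I, a k₁ * (3 * P2 k₁ ^ 2 - 2 * P4 k₁) * a k₂ * ellp Y k₁ ^ m₁ * ellp Y k₂ ^ m₂ * ((2 * β + ellp Y k₁ + ellp Y k₂) ^ 1 * R₀₁ (α * k₁ * k₂)) +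
      3 / 32 * ∑ k₁ ∈ I, ∑ k₂ ∈ I, a k₁ * (a k₂ * (3 * P2 k₂ ^ 2 - 2 * P4 k₂)) * ellp Y k₁ ^ m₁ * ellp Y k₂ ^ m₂ * ((2 * β + ellp Y k₁ + ellp Y k₂) ^ 1 * R₀₁ (α * k₁ * k₂)) +
      18 / 32 * ∑ k₁ ∈ I, ∑ k₂ ∈ I, (a k₁ * P2 k₁) * (a k₂ * P2 k₂) * ellp Y k₁ ^ m₁ * ellp Y k₂ ^ m₂ * ((2 * β + ellp Y k₁ + ellp Y k₂) ^ 1 * R₀₁ (α * k₁ * k₂)) +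
      3 / 32 * ∑ k₁ ∈ I, ∑ k₂ ∈ I, a k₁ * a k₂ * ellp Y k₁ ^ m₁ * ellp Y k₂ ^ m₂ * ((2 * β + ellp Y k₁ + ellp Y k₂) ^ 5 * R₁₀ (α * k₁ * k₂)) -
      6 / 32 * ∑ k₁ ∈ I, ∑ k₂ ∈ I, a k₁ * P2 k₁ * a k₂ * ellp Y k₁ ^ m₁ * ellp Y k₂ ^ m₂ * ((2 * β + ellp Y k₁ + ellp Y k₂) ^ 3 * R₁₀ (α * k₁ * k₂)) -
      6 / 32 * ∑ k₁ ∈ I, ∑ k₂ ∈ I, a k₁ * (a k₂ * P2 k₂) * ellp Y k₁ ^ m₁ * ellp Y k₂ ^ m₂ * ((2 * β + ellp Y k₁ + ellp Y k₂) ^ 3 * R₁₀ (α * k₁ * k₂)) +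
      3 / 32 * ∑ k₁ ∈ I, ∑ k₂ ∈ I, a k₁ * (3 * P2 k₁ ^ 2 - 2 * P4 k₁) * a k₂ * ellp Y k₁ ^ m₁ * ellp Y k₂ ^ m₂ * ((2 * β + ellp Y k₁ + ellp Y k₂) ^ 1 * R₁₀ (α * k₁ * k₂)) +
      3 / 32 * ∑ k₁ ∈ I, ∑ k₂ ∈ I, a k₁ * (a k₂ * (3 * P2 k₂ ^ 2 - 2 * P4 k₂)) * ellp Y k₁ ^ m₁ * ellp Y k₂ ^ m₂ * ((2 * β + ellp Y k₁ + ellp Y k₂) ^ 1 * R₁₀ (α * k₁ * k₂)) +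
      18 / 32 * ∑ k₁ ∈ I, ∑ k₂ ∈ I, (a k₁ * P2 k₁) * (a k₂ * P2 k₂) * ellp Y k₁ ^ m₁ * ellp Y k₂ ^ m₂ * ((2 * β + ellp Y k₁ + ellp Y k₂) ^ 1 * R₁₀ (α * k₁ * k₂)) +
      3 / 16 * ∑ k₁ ∈ I, ∑ k₂ ∈ I, a k₁ * a k₂ * ellp Y k₁ ^ m₁ * ellp Y k₂ ^ m₂ * ((2 * β + ellp Y k₁ + ellp Y k₂) ^ 4 * R₀₂ (α * k₁ * k₂)) -
      3 / 16 * ∑ k₁ ∈ I, ∑ k₂ ∈ I, a k₁ * (3 * P2 k₁ ^ 2 - 2 * P4 k₁) * a k₂ * ellp Y k₁ ^ m₁ * ellp Y k₂ ^ m₂ * ((2 * β + ellp Y k₁ + ellp Y k₂) ^ 0 * R₀₂ (α * k₁ * k₂)) -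
      3 / 16 * ∑ k₁ ∈ I, ∑ k₂ ∈ I, a k₁ * (a k₂ * (3 * P2 k₂ ^ 2 - 2 * P4 k₂)) * ellp Y k₁ ^ m₁ * ellp Y k₂ ^ m₂ * ((2 * β + ellp Y k₁ + ellp Y k₂) ^ 0 * R₀₂ (α * k₁ * k₂)) -
      18 / 16 * ∑ k₁ ∈ I, ∑ k₂ ∈ I, (a k₁ * P2 k₁) * (a k₂ * P2 k₂) * ellp Y k₁ ^ m₁ * ellp Y k₂ ^ m₂ * ((2 * β + ellp Y k₁ + ellp Y k₂) ^ 0 * R₀₂ (α * k₁ * k₂)) +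
      3 / 16 * ∑ k₁ ∈ I, ∑ k₂ ∈ I, a k₁ * a k₂ * ellp Y k₁ ^ m₁ * ellp Y k₂ ^ m₂ * ((2 * β + ellp Y k₁ + ellp Y k₂) ^ 4 * R₂₀ (α * k₁ * k₂)) -
      3 / 16 * ∑ k₁ ∈ I, ∑ k₂ ∈ I, a k₁ * (3 * P2 k₁ ^ 2 - 2 * P4 k₁) * a k₂ * ellp Y k₁ ^ m₁ * ellp Y k₂ ^ m₂ * ((2 * β + ellp Y k₁ + ellp Y k₂) ^ 0 * R₂₀ (α * k₁ * k₂)) -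
      3 / 16 * ∑ k₁ ∈ I, ∑ k₂ ∈ I, a k₁ * (a k₂ * (3 * P2 k₂ ^ 2 - 2 * P4 k₂)) * ellp Y k₁ ^ m₁ * ellp Y k₂ ^ m₂ * ((2 * β + ellp Y k₁ + ellp Y k₂) ^ 0 * R₂₀ (α * k₁ * k₂)) -
      18 / 16 * ∑ k₁ ∈ I, ∑ k₂ ∈ I, (a k₁ * P2 k₁) * (a k₂ * P2 k₂) * ellp Y k₁ ^ m₁ * ellp Y k₂ ^ m₂ * ((2 * β + ellp Y k₁ + ellp Y k₂) ^ 0 * R₂₀ (α * k₁ * k₂)) +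
      1 / 8 * ∑ k₁ ∈ I, ∑ k₂ ∈ I, a k₁ * a k₂ * ellp Y k₁ ^ m₁ * ellp Y k₂ ^ m₂ * ((2 * β + ellp Y k₁ + ellp Y k₂) ^ 3 * R₀₃ (α * k₁ * k₂)) +
      3 / 8 * ∑ k₁ ∈ I, ∑ k₂ ∈ I, a k₁ * P2 k₁ * a k₂ * ellp Y k₁ ^ m₁ * ellp Y k₂ ^ m₂ * ((2 * β + ellp Y k₁ + ellp Y k₂) ^ 1 * R₀₃ (α * k₁ * k₂)) +
      3 / 8 * ∑ k₁ ∈ I, ∑ k₂ ∈ I, a k₁ * (a k₂ * P2 k₂) * ellp Y k₁ ^ m₁ * ellp Y k₂ ^ m₂ * ((2 * β + ellp Y k₁ + ellp Y k₂) ^ 1 * R₀₃ (α * k₁ * k₂)) +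
      1 / 8 * ∑ k₁ ∈ I, ∑ k₂ ∈ I, a k₁ * a k₂ * ellp Y k₁ ^ m₁ * ellp Y k₂ ^ m₂ * ((2 * β + ellp Y k₁ + ellp Y k₂) ^ 3 * R₃₀ (α * k₁ * k₂)) +
      3 / 8 * ∑ k₁ ∈ I, ∑ k₂ ∈ I, a k₁ * P2 k₁ * a k₂ * ellp Y k₁ ^ m₁ * ellp Y k₂ ^ m₂ * ((2 * β + ellp Y k₁ + ellp Y k₂) ^ 1 * R₃₀ (α * k₁ * k₂)) +
      3 / 8 * ∑ k₁ ∈ I, ∑ k₂ ∈ I, a k₁ * (a k₂ * P2 k₂) * ellp Y k₁ ^ m₁ * ellp Y k₂ ^ m₂ * ((2 * β + ellp Y k₁ + ellp Y k₂) ^ 1 * R₃₀ (α * k₁ * k₂)) +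
      9 / 16 * ∑ k₁ ∈ I, ∑ k₂ ∈ I, a k₁ * a k₂ * ellp Y k₁ ^ m₁ * ellp Y k₂ ^ m₂ * ((2 * β + ellp Y k₁ + ellp Y k₂) ^ 4 * R₁₁ (α * k₁ * k₂)) -
      18 / 16 * ∑ k₁ ∈ I, ∑ k₂ ∈ I, a k₁ * P2 k₁ * a k₂ * ellp Y k₁ ^ m₁ * ellp Y k₂ ^ m₂ * ((2 * β + ellp Y k₁ + ellp Y k₂) ^ 2 * R₁₁ (α * k₁ * k₂)) -
      18 / 16 * ∑ k₁ ∈ I, ∑ k₂ ∈ I, a k₁ * (a k₂ * P2 k₂) * ellp Y k₁ ^ m₁ * ellp Y k₂ ^ m₂ * ((2 * β + ellp Y k₁ + ellp Y k₂) ^ 2 * R₁₁ (α * k₁ * k₂)) +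
      9 / 16 * ∑ k₁ ∈ I, ∑ k₂ ∈ I, a k₁ * (3 * P2 k₁ ^ 2 - 2 * P4 k₁) * a k₂ * ellp Y k₁ ^ m₁ * ellp Y k₂ ^ m₂ * ((2 * β + ellp Y k₁ + ellp Y k₂) ^ 0 * R₁₁ (α * k₁ * k₂)) +
      9 / 16 * ∑ k₁ ∈ I, ∑ k₂ ∈ I, a k₁ * (a k₂ * (3 * P2 k₂ ^ 2 - 2 * P4 k₂)) * ellp Y k₁ ^ m₁ * ellp Y k₂ ^ m₂ * ((2 * β + ellp Y k₁ + ellp Y k₂) ^ 0 * R₁₁ (α * k₁ * k₂)) +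
      54 / 16 * ∑ k₁ ∈ I, ∑ k₂ ∈ I, (a k₁ * P2 k₁) * (a k₂ * P2 k₂) * ellp Y k₁ ^ m₁ * ellp Y k₂ ^ m₂ * ((2 * β + ellp Y k₁ + ellp Y k₂) ^ 0 * R₁₁ (α * k₁ * k₂)) +
      9 / 8 * ∑ k₁ ∈ I, ∑ k₂ ∈ I, a k₁ * a k₂ * ellp Y k₁ ^ m₁ * ellp Y k₂ ^ m₂ * ((2 * β + ellp Y k₁ + ellp Y k₂) ^ 3 * R₁₂ (α * k₁ * k₂)) -
      9 / 8 * ∑ k₁ ∈ I, ∑ k₂ ∈ I, a k₁ * P2 k₁ * a k₂ * ellp Y k₁ ^ m₁ * ellp Y k₂ ^ m₂ * ((2 * β + ellp Y k₁ + ellp Y k₂) ^ 1 * R₁₂ (α * k₁ * k₂)) -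
      9 / 8 * ∑ k₁ ∈ I, ∑ k₂ ∈ I, a k₁ * (a k₂ * P2 k₂) * ellp Y k₁ ^ m₁ * ellp Y k₂ ^ m₂ * ((2 * β + ellp Y k₁ + ellp Y k₂) ^ 1 * R₁₂ (α * k₁ * k₂)) +
      9 / 8 * ∑ k₁ ∈ I, ∑ k₂ ∈ I, a k₁ * a k₂ * ellp Y k₁ ^ m₁ * ellp Y k₂ ^ m₂ * ((2 * β + ellp Y k₁ + ellp Y k₂) ^ 3 * R₂₁ (α * k₁ * k₂)) -
      9 / 8 * ∑ k₁ ∈ I, ∑ k₂ ∈ I, a k₁ * P2 k₁ * a k₂ * ellp Y k₁ ^ m₁ * ellp Y k₂ ^ m₂ * ((2 * β + ellp Y k₁ + ellp Y k₂) ^ 1 * R₂₁ (α * k₁ * k₂)) -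
      9 / 8 * ∑ k₁ ∈ I, ∑ k₂ ∈ I, a k₁ * (a k₂ * P2 k₂) * ellp Y k₁ ^ m₁ * ellp Y k₂ ^ m₂ * ((2 * β + ellp Y k₁ + ellp Y k₂) ^ 1 * R₂₁ (α * k₁ * k₂)) +
      3 / 4 * ∑ k₁ ∈ I, ∑ k₂ ∈ I, a k₁ * a k₂ * ellp Y k₁ ^ m₁ * ellp Y k₂ ^ m₂ * ((2 * β + ellp Y k₁ + ellp Y k₂) ^ 2 * R₁₃ (α * k₁ * k₂)) +
      3 / 4 * ∑ k₁ ∈ I, ∑ k₂ ∈ I, a k₁ * P2 k₁ * a k₂ * ellp Y k₁ ^ m₁ * ellp Y k₂ ^ m₂ * ((2 * β + ellp Y k₁ + ellp Y k₂) ^ 0 * R₁₃ (α * k₁ * k₂)) +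
      3 / 4 * ∑ k₁ ∈ I, ∑ k₂ ∈ I, a k₁ * (a k₂ * P2 k₂) * ellp Y k₁ ^ m₁ * ellp Y k₂ ^ m₂ * ((2 * β + ellp Y k₁ + ellp Y k₂) ^ 0 * R₁₃ (α * k₁ * k₂)) +
      3 / 4 * ∑ k₁ ∈ I, ∑ k₂ ∈ I, a k₁ * a k₂ * ellp Y k₁ ^ m₁ * ellp Y k₂ ^ m₂ * ((2 * β + ellp Y k₁ + ellp Y k₂) ^ 2 * R₃₁ (α * k₁ * k₂)) +
      3 / 4 * ∑ k₁ ∈ I, ∑ k₂ ∈ I, a k₁ * P2 k₁ * a k₂ * ellp Y k₁ ^ m₁ * ellp Y k₂ ^ m₂ * ((2 * β + ellp Y k₁ + ellp Y k₂) ^ 0 * R₃₁ (α * k₁ * k₂)) +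
      3 / 4 * ∑ k₁ ∈ I, ∑ k₂ ∈ I, a k₁ * (a k₂ * P2 k₂) * ellp Y k₁ ^ m₁ * ellp Y k₂ ^ m₂ * ((2 * β + ellp Y k₁ + ellp Y k₂) ^ 0 * R₃₁ (α * k₁ * k₂)) +
      9 / 4 * ∑ k₁ ∈ I, ∑ k₂ ∈ I, a k₁ * a k₂ * ellp Y k₁ ^ m₁ * ellp Y k₂ ^ m₂ * ((2 * β + ellp Y k₁ + ellp Y k₂) ^ 2 * R₂₂ (α * k₁ * k₂)) -
      9 / 4 * ∑ k₁ ∈ I, ∑ k₂ ∈ I, a k₁ * P2 k₁ * a k₂ * ellp Y k₁ ^ m₁ * ellp Y k₂ ^ m₂ * ((2 * β + ellp Y k₁ + ellp Y k₂) ^ 0 * R₂₂ (α * k₁ * k₂)) -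
      9 / 4 * ∑ k₁ ∈ I, ∑ k₂ ∈ I, a k₁ * (a k₂ * P2 k₂) * ellp Y k₁ ^ m₁ * ellp Y k₂ ^ m₂ * ((2 * β + ellp Y k₁ + ellp Y k₂) ^ 0 * R₂₂ (α * k₁ * k₂)) +
      3 / 2 * ∑ k₁ ∈ I, ∑ k₂ ∈ I, a k₁ * a k₂ * ellp Y k₁ ^ m₁ * ellp Y k₂ ^ m₂ * ((2 * β + ellp Y k₁ + ellp Y k₂) ^ 1 * R₂₃ (α * k₁ * k₂)) +
      3 / 2 * ∑ k₁ ∈ I, ∑ k₂ ∈ I, a k₁ * a k₂ * ellp Y k₁ ^ m₁ * ellp Y k₂ ^ m₂ * ((2 * β + ellp Y k₁ + ellp Y k₂) ^ 1 * R₃₂ (α * k₁ * k₂)) +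
      1 * ∑ k₁ ∈ I, ∑ k₂ ∈ I, a k₁ * a k₂ * ellp Y k₁ ^ m₁ * ellp Y k₂ ^ m₂ * ((2 * β + ellp Y k₁ + ellp Y k₂) ^ 0 * R₃₃ (α * k₁ * k₂)) := by
    simp (maxSteps := 4000000) only [Finset.mul_sum, ← Finset.sum_add_distrib, ← Finset.sum_sub_distrib]
    refine Finset.sum_congr rfl fun k₁ _ ↦ Finset.sum_congr rfl fun k₂ _ ↦ ?_
    ring
  rw [hid]
  -- move the row decorations to the column
  have hsw1 : ∑ k₁ ∈ I, ∑ k₂ ∈ I, a k₁ * (3 * P2 k₁ ^ 2 - 2 * P4 k₁) * a k₂ * ellp Y k₁ ^ m₁ * ellp Y k₂ ^ m₂ * ((2 * β + ellp Y k₁ + ellp Y k₂) ^ 2 * R₀₀ (α * k₁ * k₂)) =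
      ∑ k₁ ∈ I, ∑ k₂ ∈ I, a k₁ * (a k₂ * (3 * P2 k₂ ^ 2 - 2 * P4 k₂)) * ellp Y k₁ ^ m₂ * ellp Y k₂ ^ m₁ * ((2 * β + ellp Y k₁ + ellp Y k₂) ^ 2 * R₀₀ (α * k₁ * k₂)) := sum_swap_decor_Lpow a (fun k ↦ 3 * P2 k ^ 2 - 2 * P4 k) R₀₀ Y α β m₁ m₂ 2 I
  have hsw2 : ∑ k₁ ∈ I, ∑ k₂ ∈ I, a k₁ * (15 * P2 k₁ ^ 3 - 30 * P2 k₁ * P4 k₁ + 16 * P6 k₁) * a k₂ * ellp Y k₁ ^ m₁ * ellp Y k₂ ^ m₂ * ((2 * β + ellp Y k₁ + ellp Y k₂) ^ 0 * R₀₀ (α * k₁ * k₂)) =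
      ∑ k₁ ∈ I, ∑ k₂ ∈ I, a k₁ * (a k₂ * (15 * P2 k₂ ^ 3 - 30 * P2 k₂ * P4 k₂ + 16 * P6 k₂)) * ellp Y k₁ ^ m₂ * ellp Y k₂ ^ m₁ * ((2 * β + ellp Y k₁ + ellp Y k₂) ^ 0 * R₀₀ (α * k₁ * k₂)) := sum_swap_decor_Lpow a (fun k ↦ 15 * P2 k ^ 3 - 30 * P2 k * P4 k + 16 * P6 k) R₀₀ Y α β m₁ m₂ 0 I
  have hsw3 : ∑ k₁ ∈ I, ∑ k₂ ∈ I, (a k₁ * (3 * P2 k₁ ^ 2 - 2 * P4 k₁)) * (a k₂ * P2 k₂) * ellp Y k₁ ^ m₁ * ellp Y k₂ ^ m₂ * ((2 * β + ellp Y k₁ + ellp Y k₂) ^ 0 * R₀₀ (α * k₁ * k₂)) =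
      ∑ k₁ ∈ I, ∑ k₂ ∈ I, (a k₁ * P2 k₁) * (a k₂ * (3 * P2 k₂ ^ 2 - 2 * P4 k₂)) * ellp Y k₁ ^ m₂ * ellp Y k₂ ^ m₁ * ((2 * β + ellp Y k₁ + ellp Y k₂) ^ 0 * R₀₀ (α * k₁ * k₂)) := sum_swap_both_Lpow a (fun k ↦ 3 * P2 k ^ 2 - 2 * P4 k) P2 R₀₀ Y α β m₁ m₂ 0 I
  have hsw5 : ∑ k₁ ∈ I, ∑ k₂ ∈ I, a k₁ * (3 * P2 k₁ ^ 2 - 2 * P4 k₁) * a k₂ * ellp Y k₁ ^ m₁ * ellp Y k₂ ^ m₂ * ((2 * β + ellp Y k₁ + ellp Y k₂) ^ 1 * R₀₁ (α * k₁ * k₂)) =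
      ∑ k₁ ∈ I, ∑ k₂ ∈ I, a k₁ * (a k₂ * (3 * P2 k₂ ^ 2 - 2 * P4 k₂)) * ellp Y k₁ ^ m₂ * ellp Y k₂ ^ m₁ * ((2 * β + ellp Y k₁ + ellp Y k₂) ^ 1 * R₀₁ (α * k₁ * k₂)) := sum_swap_decor_Lpow a (fun k ↦ 3 * P2 k ^ 2 - 2 * P4 k) R₀₁ Y α β m₁ m₂ 1 I
  have hsw7 : ∑ k₁ ∈ I, ∑ k₂ ∈ I, a k₁ * (3 * P2 k₁ ^ 2 - 2 * P4 k₁) * a k₂ * ellp Y k₁ ^ m₁ * ellp Y k₂ ^ m₂ * ((2 * β + ellp Y k₁ + ellp Y k₂) ^ 1 * R₁₀ (α * k₁ * k₂)) =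
      ∑ k₁ ∈ I, ∑ k₂ ∈ I, a k₁ * (a k₂ * (3 * P2 k₂ ^ 2 - 2 * P4 k₂)) * ellp Y k₁ ^ m₂ * ellp Y k₂ ^ m₁ * ((2 * β + ellp Y k₁ + ellp Y k₂) ^ 1 * R₁₀ (α * k₁ * k₂)) := sum_swap_decor_Lpow a (fun k ↦ 3 * P2 k ^ 2 - 2 * P4 k) R₁₀ Y α β m₁ m₂ 1 I
  have hsw8 : ∑ k₁ ∈ I, ∑ k₂ ∈ I, a k₁ * (3 * P2 k₁ ^ 2 - 2 * P4 k₁) * a k₂ * ellp Y k₁ ^ m₁ * ellp Y k₂ ^ m₂ * ((2 * β + ellp Y k₁ + ellp Y k₂) ^ 0 * R₀₂ (α * k₁ * k₂)) =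
      ∑ k₁ ∈ I, ∑ k₂ ∈ I, a k₁ * (a k₂ * (3 * P2 k₂ ^ 2 - 2 * P4 k₂)) * ellp Y k₁ ^ m₂ * ellp Y k₂ ^ m₁ * ((2 * β + ellp Y k₁ + ellp Y k₂) ^ 0 * R₀₂ (α * k₁ * k₂)) := sum_swap_decor_Lpow a (fun k ↦ 3 * P2 k ^ 2 - 2 * P4 k) R₀₂ Y α β m₁ m₂ 0 I
  have hsw9 : ∑ k₁ ∈ I, ∑ k₂ ∈ I, a k₁ * (3 * P2 k₁ ^ 2 - 2 * P4 k₁) * a k₂ * ellp Y k₁ ^ m₁ * ellp Y k₂ ^ m₂ * ((2 * β + ellp Y k₁ + ellp Y k₂) ^ 0 * R₂₀ (α * k₁ * k₂)) =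
      ∑ k₁ ∈ I, ∑ k₂ ∈ I, a k₁ * (a k₂ * (3 * P2 k₂ ^ 2 - 2 * P4 k₂)) * ellp Y k₁ ^ m₂ * ellp Y k₂ ^ m₁ * ((2 * β + ellp Y k₁ + ellp Y k₂) ^ 0 * R₂₀ (α * k₁ * k₂)) := sum_swap_decor_Lpow a (fun k ↦ 3 * P2 k ^ 2 - 2 * P4 k) R₂₀ Y α β m₁ m₂ 0 I
  have hsw13 : ∑ k₁ ∈ I, ∑ k₂ ∈ I, a k₁ * (3 * P2 k₁ ^ 2 - 2 * P4 k₁) * a k₂ * ellp Y k₁ ^ m₁ * ellp Y k₂ ^ m₂ * ((2 * β + ellp Y k₁ + ellp Y k₂) ^ 0 * R₁₁ (α * k₁ * k₂)) =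
      ∑ k₁ ∈ I, ∑ k₂ ∈ I, a k₁ * (a k₂ * (3 * P2 k₂ ^ 2 - 2 * P4 k₂)) * ellp Y k₁ ^ m₂ * ellp Y k₂ ^ m₁ * ((2 * β + ellp Y k₁ + ellp Y k₂) ^ 0 * R₁₁ (α * k₁ * k₂)) := sum_swap_decor_Lpow a (fun k ↦ 3 * P2 k ^ 2 - 2 * P4 k) R₁₁ Y α β m₁ m₂ 0 I
  rw [sum_swap_decor_Lpow a P2 R₀₀ Y α β m₁ m₂ 4 I,
    hsw1,
    hsw2,
    hsw3,
    sum_swap_decor_Lpow a P2 R₀₁ Y α β m₁ m₂ 3 I,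
    hsw5,
    sum_swap_decor_Lpow a P2 R₁₀ Y α β m₁ m₂ 3 I,
    hsw7,
    hsw8,
    hsw9,
    sum_swap_decor_Lpow a P2 R₀₃ Y α β m₁ m₂ 1 I,
    sum_swap_decor_Lpow a P2 R₃₀ Y α β m₁ m₂ 1 I,
    sum_swap_decor_Lpow a P2 R₁₁ Y α β m₁ m₂ 2 I,
    hsw13,
    sum_swap_decor_Lpow a P2 R₁₂ Y α β m₁ m₂ 1 I,
    sum_swap_decor_Lpow a P2 R₂₁ Y α β m₁ m₂ 1 I,
    sum_swap_decor_Lpow a P2 R₁₃ Y α β m₁ m₂ 0 I,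
    sum_swap_decor_Lpow a P2 R₃₁ Y α β m₁ m₂ 0 I,
    sum_swap_decor_Lpow a P2 R₂₂ Y α β m₁ m₂ 0 I]
  -- numerics of the prefactors
  have hΛ1 : Λ ≤ Λ ^ 6 := le_self_pow₀ hΛ (by norm_num)
  have hΛ2 : Λ ^ 2 ≤ Λ ^ 6 := pow_le_pow_right₀ hΛ (by norm_num)
  have hΛ3 : Λ ^ 3 ≤ Λ ^ 6 := pow_le_pow_right₀ hΛ (by norm_num)
  have hΛ4 : Λ ^ 4 ≤ Λ ^ 6 := pow_le_pow_right₀ hΛ (by norm_num)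
  have hΛ5 : Λ ^ 5 ≤ Λ ^ 6 := pow_le_pow_right₀ hΛ (by norm_num)
  have hΛ06 : 1 ≤ Λ ^ 6 := one_le_pow₀ hΛ
  have hΛ14 : Λ ≤ Λ ^ 4 := le_self_pow₀ hΛ (by norm_num)
  have hΛ24 : Λ ^ 2 ≤ Λ ^ 4 := pow_le_pow_right₀ hΛ (by norm_num)
  have hΛ34 : Λ ^ 3 ≤ Λ ^ 4 := pow_le_pow_right₀ hΛ (by norm_num)
  have hΛ04 : 1 ≤ Λ ^ 4 := one_le_pow₀ hΛ
  have hΛ12 : Λ ≤ Λ ^ 2 := le_self_pow₀ hΛ (by norm_num)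
  have hΛ02 : 1 ≤ Λ ^ 2 := one_le_pow₀ hΛ
  have e6 : (4 * Λ) ^ 6 = 4096 * Λ ^ 6 := by ring
  have e5 : (4 * Λ) ^ 5 = 1024 * Λ ^ 5 := by ring
  have e4 : (4 * Λ) ^ 4 = 256 * Λ ^ 4 := by ring
  have e3 : (4 * Λ) ^ 3 = 64 * Λ ^ 3 := by ring
  have e2 : (4 * Λ) ^ 2 = 16 * Λ ^ 2 := by ring
  have e1 : (4 * Λ) ^ 1 = 4 * Λ := by ring
  have e0 : (4 * Λ) ^ 0 = 1 := by ring
  rw [e6] at g1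
  rw [e5] at g11 g17
  rw [e4] at g2 g3 g23 g27 g37
  rw [e3] at g12 g13 g18 g19 g31 g34 g43 g46
  rw [e2] at g4 g5 g6 g38 g39 g49 g52 g55
  rw [e1] at g14 g15 g16 g20 g21 g22 g32 g33 g35 g36 g44 g45 g47 g48 g58 g59
  rw [e0] at g7 g8 g9 g10 g24 g25 g26 g28 g29 g30 g40 g41 g42 g50 g51 g53 g54 g56 g57 g60
  have k01 : Λ ^ 5 * X₀ ≤ Λ ^ 6 * X₀ := mul_le_mul_of_nonneg_right hΛ5 hX₀0
  have k02 : Λ ^ 4 * X₀ ≤ Λ ^ 6 * X₀ := mul_le_mul_of_nonneg_right hΛ4 hX₀0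
  have k03 : Λ ^ 3 * X₀ ≤ Λ ^ 6 * X₀ := mul_le_mul_of_nonneg_right hΛ3 hX₀0
  have k04 : Λ ^ 2 * X₀ ≤ Λ ^ 6 * X₀ := mul_le_mul_of_nonneg_right hΛ2 hX₀0
  have k05 : Λ * X₀ ≤ Λ ^ 6 * X₀ := mul_le_mul_of_nonneg_right hΛ1 hX₀0
  have k06 : 1 * X₀ ≤ Λ ^ 6 * X₀ := mul_le_mul_of_nonneg_right hΛ06 hX₀0
  have k21 : Λ ^ 3 * X₂ ≤ Λ ^ 4 * X₂ := mul_le_mul_of_nonneg_right hΛ34 hX₂0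
  have k22 : Λ ^ 2 * X₂ ≤ Λ ^ 4 * X₂ := mul_le_mul_of_nonneg_right hΛ24 hX₂0
  have k23 : Λ * X₂ ≤ Λ ^ 4 * X₂ := mul_le_mul_of_nonneg_right hΛ14 hX₂0
  have k24 : 1 * X₂ ≤ Λ ^ 4 * X₂ := mul_le_mul_of_nonneg_right hΛ04 hX₂0
  have k41 : Λ * X₄ ≤ Λ ^ 2 * X₄ := mul_le_mul_of_nonneg_right hΛ12 hX₄0
  have k42 : 1 * X₄ ≤ Λ ^ 2 * X₄ := mul_le_mul_of_nonneg_right hΛ02 hX₄0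
  have kB1 : Λ * XB ≤ Λ ^ 2 * XB := mul_le_mul_of_nonneg_right hΛ12 hXB0
  have kB2 : 1 * XB ≤ Λ ^ 2 * XB := mul_le_mul_of_nonneg_right hΛ02 hXB0
  have htot : (729 * Λ ^ 6 * Ψ₀ + 140 * Λ ^ 4 * Ψ₂ + 5 * Λ ^ 2 * Ψ₄ + Ψ₆ + 15 * Λ ^ 2 * ΨB + ΨBD) * Real.log Y ^ (m₁ + m₂) =
      729 * (Λ ^ 6 * X₀) + 140 * (Λ ^ 4 * X₂) + 5 * (Λ ^ 2 * X₄) + X₆ + 15 * (Λ ^ 2 * XB) + XBD := by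
    rw [hX₀, hX₂, hX₄, hX₆, hXB, hXBD]; ring
  rw [htot]
  rw [abs_le] at g1 g2 g3 g4 g5 g6 g7 g8 g9 g10 g11 g12 g13 g14 g15 g16 g17 g18 g19 g20 g21 g22 g23 g24 g25 g26 g27 g28 g29 g30 g31 g32 g33 g34 g35 g36 g37 g38 g39 g40 g41 g42 g43 g44 g45 g46 g47 g48 g49 g50 g51 g52 g53 g54 g55 g56 g57 g58 g59 g60 ⊢
  constructor <;> linarith [g1.1, g1.2, g2.1, g2.2, g3.1, g3.2, g4.1, g4.2, g5.1, g5.2, g6.1, g6.2, g7.1, g7.2, g8.1, g8.2, g9.1, g9.2, g10.1, g10.2, g11.1, g11.2, g12.1, g12.2, g13.1, g13.2, g14.1, g14.2, g15.1, g15.2, g16.1, g16.2, g17.1, g17.2, g18.1, g18.2, g19.1, g19.2, g20.1, g20.2, g21.1, g21.2, g22.1, g22.2, g23.1, g23.2, g24.1, g24.2, g25.1, g25.2, g26.1, g26.2, g27.1, g27.2, g28.1, g28.2, g29.1, g29.2, g30.1, g30.2, g31.1, g31.2, g32.1, g32.2, g33.1, g33.2, g34.1, g34.2, g35.1, g35.2,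 g36.1, g36.2, g37.1, g37.2, g38.1, g38.2, g39.1, g39.2, g40.1, g40.2, g41.1, g41.2, g42.1, g42.2, g43.1, g43.2, g44.1, g44.2, g45.1, g45.2, g46.1, g46.2, g47.1, g47.2, g48.1, g48.2, g49.1, g49.2, g50.1, g50.2, g51.1, g51.2, g52.1, g52.2, g53.1, g53.2, g54.1, g54.2, g55.1, g55.2, g56.1, g56.2, g57.1, g57.2, g58.1, g58.2, g59.1, g59.2, g60.1, g60.2, k01, k02, k03, k04, k05, k06, k21, k22, k23, k24,
    k41, k42, kB1, kB2, hX₀0, hX₂0, hX₄0, hX₆0, hXB0, hXBD0]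

end Summit.Parity.GeneralizedHardyLittlewood.Theorems.MomentsBeyondDiagonal.DiagCorner

end
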